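import Summits.QuantumFields.YangMills.Theorems.BalabanUVNodesN06HTransposeAtPinsPhysR
import Literature.MathematicalPhysics.QuantumFieldTheory.Balaban1983to89.B9Eq3126HTransposeScaledMajorant
import Literature.MathematicalPhysics.QuantumFieldTheory.Balaban1983to89.B9Eq3136HstarJAtPinsLetterFamily

/-!
# BalabanUVNodes ∕ N06 ([B9], `Dag.B9_main`) — n06-w8's TRANSPOSE ROAD TO `hD2sup` RE-PINNED AT PRINT's `G′_phys` (def-Y `GpPhysY`; the Sect.-D letters of the
# certificate of record): `hD2sup` ⟸ `hC2 + hreg + hGDsup + hCsup` for `Δ⁽²⁾ = delta2OfY … (GpPhysY …) (𝔠 x).form` (programme P-D2, leg F-B)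

T. Bałaban, *Propagators for lattice gauge theories in a background field*, Commun. Math. Phys. **99** (1985) 389–434 [`Balaban1985BackgroundPropagators`, "B9"],
(3.134)–(3.137) pp. 422–423, (3.126) p. 420, (3.130) p. 421, (3.132)–(3.133) p. 422, (3.36) p. 396, p. 398, p. 421 («C⁽²⁾(A) equals to LʲηC_j⁽²⁾(A) on Λ_j»);
[5] = T. Bałaban, *Averaging operations for lattice gauge theories*, Commun. Math. Phys. **98** (1985) 17–51 [`Balaban1985Averaging`], (149) p. 40; [4] = T. Bałaban,
*Propagators and renormalization transformations for lattice gauge theories. II*, Commun. Math. Phys. **96** (1984) 223–250 [`Balaban1984PropagatorsII`], (2.51)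
p. 232, (2.54), Lemma 2.1 (2.60)–(2.61) pp. 233–234.

WHY (cell `pub-ymgap`, node N06, bundle F7 rows 20–21, seat dag-n06-l g33; LOCATED-D2).  Seat n06-w8's files (2026-08-28) `…N06Delta2AtPinsC2PhysR` (F6-R),
`…N06HstarJAtPinsWPhysR` (F8′-R) and `…N06HTransposeAtPinsPhysR` (F10-R) derive the certificate's displayed binder `hD2sup` ((3.137)) at def-Y's genuine
residual from [5] (149) (`hC2`), a flat sup letter of `G_D` (`hGDsup`) and the weighted (3.132) letter (`hCsup`) — but pinned at the LATTICE-UNIT `G′ = GpY`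
(`resYOfC2`, `HDY … GpY …`, `GDY … GpY …`, `CcoK … GpY …`), while the certificate of record (`…N06AtOpsYNuOfRecordV6EPairVH`, def-Y `Node00.OpsYRecordV4P`)
reads every Sect.-D letter at print's `G′_phys = η²·G′` (`GpPhysY`): `(𝔬12 x).G U = GcoK … (GDY … GpPhysY …) U`, `(𝔬12 x).C U = CcoK … GpPhysY … U`,
`(𝔬12 x).Hm U = HcoK … (HDY … GpPhysY …) U` (n06-w8's own successor pointer (b): «re-pin in one `Gp :=` each when def-Y's GpPhysY residual lands» —
def-Y g29 INTENT-81 `Node00/OpsYDelta2FormP.resYOfC2P`, `resYOfC2P_Δ2 : (resYOfC2P … 𝔠 x).Δ2 = delta2OfY … (GpPhysY …) (𝔠 x).form`).  THIS FILE is that re-pin,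
with nothing of mathematics added: the Literature cores are `Gp`-generic (`B9Delta2FormMajorant.hasMajorant_coordOpK_delta2OfY`,
`B9Eq3126HTransposeCoords.hasMajorantHom_CQG_of_letters`, `…isTransposePair_HcoK_HDY_physY` (F9 v1.2), `B9Eq336RegularAtAllBondsP`), and the `(H\*J)` wrapper is
dag-n08-d's GENERIC-LETTER edition `B9Eq3136HstarJAtPinsLetterFamily.norm_trAdjY_JY_le_of_transpose_schemas_wR` at `O x := HDY … (GpPhysY …)`.
* OBJECTS at def-Y's class-parametric carrier too: `𝔬12 : Ops (geo9Y x) (bg9YR … R₁ R₂ x) …`, `D2coK ∕ GcoK ∕ CcoK ∕ HcoK ∕ QcoKH … (bg9YR … R₁ R₂ x) (fun U => U) …` —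
  the certificate's own spelling (`ops312RY`); n06-w8's R-files kept the objects at `bg9Y … x` (the certificate of 2026-08-28 morning), which today's `Ops`-typed
  record no longer accepts (the Literature cores are generic in the background record `B`, so only the spelling moves).
* ★★ `hD2sup_of_form_schemas_wRP` — F6-R's `hD2sup_of_form_schemas_wR` at `G′_phys` (statement + proof verbatim, `GpY ↦ GpPhysY`; conclusion about the explicit
  `delta2OfY … GpPhysY …` term).
* ★★ `hHT_of_GD_C_lettersRP` — F10-R's transpose letter at `G′_phys` (`isTransposePair_HcoK_HDY_physY`).
* ★★★ `hD2sup_of_GD_C_lettersRP` — F10-R's `hD2sup_of_GD_C_lettersR` at `G′_phys`: the certificate's `hD2sup` binder (edition ≥ 30 shape, regime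
  `(bg9YR … R₁ R₂ x).Reg335∕336 c α₀ U`, `c` free, `hG : MemOfFam SU(N) R₁`) at `Δ2 := delta2OfY … GpPhysY … (𝔠 x).form` from `hC2` ([5] (149) at the weight `wC`
  with `wC·(W_C·(Lʲη)⁻³) ≤ (Lʲη)⁻²` — print's «C⁽²⁾ = LʲηC_j⁽²⁾ on Λ_j», p. 421, lit-balaban-r06 page check 2026-08-30), `hGDsup` (flat sup letter of `G_D` at rate
  `(1−α)δ₀` — SUPPLIED before the leaf by this seat's `…N06GDSupLegAtPinsPUW.gdsup_of_pins`, leg F-A), `hCsup` (weighted (3.132) letter at rate `δ₀`) and `hreg`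
  (r06's `RegularAt` at every fine bond — a THEOREM at print's class by n06-w8's `regularAt_pinScale_of_regYP336`, discharged in leg F-D through the certificate's
  `hRP2`).
HONEST FRAMING.  Kernel bookkeeping re-instantiated; COUNT-NEUTRAL; [5] (149), Thm 3.12's `G_D` letter and the weighted (3.132) letter stay HYPOTHESES here; N06 NOT
discharged; K1 NOT closed.  One finite 𝕋⁴ programme at fixed `ε` — NOT continuum, NOT OS, NOT the mass gap ∕ Clay.  0 `def`, 0 `sorry`.  NEW file; n06-w8's and
n08-d's files untouched.
-/

noncomputable section

namespace Summit.QuantumFields.YangMills.BalabanUVNodes.N06Delta2AtPinsPhysP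

open Literature.MathematicalPhysics.QuantumFieldTheory.Balaban1983to89
open Literature.MathematicalPhysics.QuantumFieldTheory.Balaban1983to89.Node00 (CfgY FBondY IBondY GpY parSymY parBY trDualMatY trAdjY JY Stage3Params C2Y
  resYOfC2 resYOfC2_Δ2 resYOfC2_Δ2_isSymmTr)
open Literature.MathematicalPhysics.QuantumFieldTheory.Balaban1983to89.B9Eq3132SectDLetters (HDY)
open Literature.MathematicalPhysics.QuantumFieldTheory.Balaban1983to89.B9Thm34Ext (toB6)
open Literature.MathematicalPhysics.QuantumFieldTheory.Balaban1983to89.B11SectG (RowSum)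
open Literature.MathematicalPhysics.QuantumFieldTheory.Balaban1983to89.B6RandomWalk (HasMajorant hasMajorant_mono)
open Literature.MathematicalPhysics.QuantumFieldTheory.Balaban1983to89.B9SectDL2Decay (BlockBd)
open Literature.MathematicalPhysics.QuantumFieldTheory.Balaban1983to89.B9Thm312Whole (GeoOK)
open Literature.MathematicalPhysics.QuantumFieldTheory.Balaban1983to89.B9RWSums343to347Whole (Facts347)
open Literature.MathematicalPhysics.QuantumFieldTheory.Balaban1983to89.B9RWSumsDefinitePins (PinPrims)
open Literature.MathematicalPhysics.QuantumFieldTheory.Balaban1983to89.B9RWSums347DefiniteFaces (exp261 lemma21Pack_geo9Y)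
open Literature.MathematicalPhysics.QuantumFieldTheory.Balaban1983to89.B9RowSum261DefiniteFaces (rowConst261 rowConst261_nonneg rowConst261_spec_of_rowSum261)
open Literature.MathematicalPhysics.QuantumFieldTheory.Balaban1983to89.B9RWSums346Schur (scaleTransfer_len_rpow)
open Literature.MathematicalPhysics.QuantumFieldTheory.Balaban1983to89.B9PinMembersKLevelV1 (MemberY geo9Y bg9Y)
open Literature.MathematicalPhysics.QuantumFieldTheory.Balaban1983to89.B9BackgroundsKLevelV1R (RegFamY bg9YR MemOfFam)
open Literature.MathematicalPhysics.QuantumFieldTheory.Balaban1983to89.B9GeoLemma21KLevelV1 (geo9Y_len_pos geo9Y_dist_triangle geo9Y_dist_comm rowSum261_geo9Y)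
open Literature.MathematicalPhysics.QuantumFieldTheory.Balaban1983to89.B9GeoNormsKLevelV1 (geo9K_dist_nonneg)
open Literature.MathematicalPhysics.QuantumFieldTheory.Balaban1983to89.B7Prop2SpecialUnitary (specialUnitaryUnits specialUnitaryUnits_le_unitaryUnits)
open Literature.MathematicalPhysics.QuantumFieldTheory.Balaban1983to89.B9CoReadingCoords (XBK blkBK)
open Literature.MathematicalPhysics.QuantumFieldTheory.Balaban1983to89.B9CoReadingCoordsH (XHK)
open Literature.MathematicalPhysics.QuantumFieldTheory.Balaban1983to89.B9CoReadingCoordsS (XSK)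
open Literature.MathematicalPhysics.QuantumFieldTheory.Balaban1983to89.B9CoReadingCoordsTranspose (TrIdx trBasis)
open Literature.MathematicalPhysics.QuantumFieldTheory.Balaban1983to89.B9Thm39ReadingCoords (cR39 basisBound39)
open Literature.MathematicalPhysics.QuantumFieldTheory.Balaban1983to89.Node00.OpsYSectDCoords (cR39_trBasis_pos)
open Literature.MathematicalPhysics.QuantumFieldTheory.Balaban1983to89.B9PerturbationL2Delta2 (D2coK blockBd_d2coK_of_sup_symm)
open Literature.MathematicalPhysics.QuantumFieldTheory.Balaban1983to89.B9Delta2FormMajorant (C2FormMaj hasMajorant_coordOpK_delta2OfY)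
open scoped Matrix.Norms.L2Operator
open Literature.MathematicalPhysics.QuantumFieldTheory.Balaban1983to89
open Literature.MathematicalPhysics.QuantumFieldTheory.Balaban1983to89.Node00 (CfgY FBondY IBondY GpY parSymY parBY trDualMatY trAdjY JY Stage3Params C2Y
  resYOfC2 etaBY)
open Literature.MathematicalPhysics.QuantumFieldTheory.Balaban1983to89.Node00.OpsYSectDCoords (QcoKH CcoK cR39_trBasis_pos)
open Literature.MathematicalPhysics.QuantumFieldTheory.Balaban1983to89.B9Eq3132SectDLetters (GDY HDY)
open Literature.MathematicalPhysics.QuantumFieldTheory.Balaban1983to89.B9Thm34Ext (toB6)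
open Literature.MathematicalPhysics.QuantumFieldTheory.Balaban1983to89.B6RandomWalk (HasMajorant Ineq261)
open Literature.MathematicalPhysics.QuantumFieldTheory.Balaban1983to89.B6RandomWalkHom (HasMajorantHom)
open Literature.MathematicalPhysics.QuantumFieldTheory.Balaban1983to89.B9Thm37Glue (IsTransposePair)
open Literature.MathematicalPhysics.QuantumFieldTheory.Balaban1983to89.B9RWSumsDefinitePins (PinPrims)
open Literature.MathematicalPhysics.QuantumFieldTheory.Balaban1983to89.B9RWSums347DefiniteFaces (exp261 lemma21Pack_geo9Y)
open Literature.MathematicalPhysics.QuantumFieldTheory.Balaban1983to89.B9RowSum261DefiniteFaces (rowConst261)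
open Literature.MathematicalPhysics.QuantumFieldTheory.Balaban1983to89.B9PinMembersKLevelV1 (MemberY geo9Y bg9Y)
open Literature.MathematicalPhysics.QuantumFieldTheory.Balaban1983to89.B9PinGeometryKLevelV1 (c35Y)
open Literature.MathematicalPhysics.QuantumFieldTheory.Balaban1983to89.B9GeoLemma21KLevelV1 (geo9Y_len_pos geo9Y_dist_triangle)
open Literature.MathematicalPhysics.QuantumFieldTheory.Balaban1983to89.B9BackgroundsKLevelV1 (shiftsV1 mem_of_reg335)
open Literature.MathematicalPhysics.QuantumFieldTheory.Balaban1983to89.B7Prop2SpecialUnitary (specialUnitaryUnits specialUnitaryUnits_le_unitaryUnits)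
open Literature.MathematicalPhysics.QuantumFieldTheory.Balaban1983to89.B9CoReadingCoords (XBK blkBK GcoK)
open Literature.MathematicalPhysics.QuantumFieldTheory.Balaban1983to89.B9CoReadingCoordsH (XHK blkHK HcoK)
open Literature.MathematicalPhysics.QuantumFieldTheory.Balaban1983to89.B9CoReadingCoordsTranspose (TrIdx trBasis)
open Literature.MathematicalPhysics.QuantumFieldTheory.Balaban1983to89.B9Thm39ReadingCoords (basisBound39)
open Literature.MathematicalPhysics.QuantumFieldTheory.Balaban1983to89.B9QstarLettersAtPins (parBY_norm_le_one_of_reg335)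
open Literature.MathematicalPhysics.QuantumFieldTheory.Balaban1983to89.B9Eq336CurrentBound (RegularAt)
open Literature.MathematicalPhysics.QuantumFieldTheory.Balaban1983to89.B6GlobalChartV1 (PV blkV1)
open Literature.MathematicalPhysics.QuantumFieldTheory.Balaban1983to89.B6Ineq2142KLevelV1 (β)
open Literature.MathematicalPhysics.QuantumFieldTheory.Balaban1983to89.B6Geom246MultiLevelTorus (geomT)
open Literature.MathematicalPhysics.QuantumFieldTheory.Balaban1983to89.B9GeoNormsKLevelV1 (geo9K)
open Literature.MathematicalPhysics.QuantumFieldTheory.Balaban1983to89.B9Eq3126HTransposeCoords (isTransposePair_HcoK_HDY_parSymY hasMajorantHom_CQG_of_letters)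
open Summit.QuantumFields.YangMills.BalabanUVNodes.N06HstarJAtPinsWPhysR (hHJ_of_transpose_schemas_wR hD2sup_of_transpose_schemas_wR)
open Literature.MathematicalPhysics.QuantumFieldTheory.Balaban1983to89.B9BackgroundsKLevelV1R (RegFamY bg9YR MemOfFam regYP335 regYP336 memOfFam_regYP335)
open Literature.MathematicalPhysics.QuantumFieldTheory.Balaban1983to89.B9BackgroundsKLevelV1P (bg9YP)
open Literature.MathematicalPhysics.QuantumFieldTheory.Balaban1983to89.B7Prop2SpecialUnitary (specialUnitaryUnits_le_U1)
open Literature.MathematicalPhysics.QuantumFieldTheory.Balaban1983to89.B9Eq336RegularAtAllBondsP (regularAt_pinScale_of_regYP336)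
open scoped Matrix.Norms.L2Operator
open Literature.MathematicalPhysics.QuantumFieldTheory.Balaban1983to89.Node00 (delta2OfY GpPhysY etaBY)
open Literature.MathematicalPhysics.QuantumFieldTheory.Balaban1983to89.B9Eq3126HTransposeCoords (isTransposePair_HcoK_HDY_physY)
open Literature.MathematicalPhysics.QuantumFieldTheory.Balaban1983to89.B9Eq3136HstarJAtPinsLetterFamily (norm_trAdjY_JY_le_of_transpose_schemas_wR)
open Literature.MathematicalPhysics.QuantumFieldTheory.Balaban1983to89.B9Eq336RegularAtAllBondsP (regularAt_pinScale_of_regYP336)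
open Literature.MathematicalPhysics.QuantumFieldTheory.Balaban1983to89.B9Eq3126HTransposeScaledMajorant (hasMajorantHom_CQG_of_letters_sq)
open Literature.MathematicalPhysics.QuantumFieldTheory.Balaban1983to89.B9RWSums347DefiniteFaces (facts347_exp261_geo9Y)
open Literature.MathematicalPhysics.QuantumFieldTheory.Balaban1983to89.B9GeoLemma21KLevelV1 (rowSum261_geo9Y geo9Y_dist_comm geo9Y_len_pos)

variable {N : ℕ} [NeZero N] {θ : Stage3Params} {Mstar : ℕ}
variable [∀ x : MemberY θ.d₆ θ.ℓ₆ θ.hd' θ.hL' θ.b₀ θ.b₁ Mstar, Fintype (geo9Y x).Site]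

/-- the kernel domination: `r·(…·(t·θ)·…)·W·e ≤ θ₂·θ·W·e` once `r·(…·t·…) ≤ θ₂` and `θ, W, e ≥ 0`. [cite: Balaban1985BackgroundPropagators, (3.137) p.423, bookkeeping] -/
private theorem kernel_dom {r n b κ t θ C c θ₂ W e : ℝ} (h : r * (n * b * κ * t * C * c) ≤ θ₂) (hθ : 0 ≤ θ) (hW : 0 ≤ W) (he : 0 ≤ e) :
    r * (n * b * κ * (t * θ) * C * c) * W * e ≤ θ₂ * θ * W * e := by
  have h1 : r * (n * b * κ * (t * θ) * C * c) * W * e = (r * (n * b * κ * t * C * c)) * (θ * (W * e)) := by ring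
  rw [h1, show θ₂ * θ * W * e = θ₂ * (θ * (W * e)) by ring]
  exact mul_le_mul_of_nonneg_right h (mul_nonneg hθ (mul_nonneg hW he))

/-- ★★ (GpPhysY TWIN of n06-w8's `…N06Delta2AtPinsC2PhysR.hD2sup_of_form_schemas_wR`; statement and proof verbatim with `GpY ↦ GpPhysY` and the residual written as the explicit `delta2OfY … GpPhysY …` term = def-Y's `resYOfC2P … 𝔠` by `resYOfC2P_Δ2`) **`hD2sup` FOR ANY WEIGHT SPLIT, AT `G′_phys`**: as `hD2sup_of_form_schemas`, with the form letter at a free weight family `w_C` and the current letter at a free weight family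
`w_H`, `0 ≦ w_C, w_H`, `w_C(c)·w_H(c) ≦ ((Lʲη)_c²)⁻¹` — conclusion unchanged (edition 30's `hD2sup` at `𝔯 := resYOfC2 N θ M⋆ 𝔠`).
[cite: Balaban1985BackgroundPropagators, (3.136)–(3.137) pp.422–423, (3.11) p.392, p.398; Balaban1985Averaging, (149) p.40; Balaban1984PropagatorsII, (2.51) p.232, (2.54), (2.60)–(2.61) pp.233–234] -/
theorem hD2sup_of_form_schemas_wRP (q : PinPrims) (hq : q.OK) (H : MemberY θ.d₆ θ.ℓ₆ θ.hd' θ.hL' θ.b₀ θ.b₁ Mstar → Prop) (𝔠 : C2Y N θ Mstar)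
    (R₁ R₂ : RegFamY θ.d₆ θ.ℓ₆ θ.hd' θ.hL' θ.b₀ θ.b₁ Mstar (Matrix (Fin N) (Fin N) ℂ)) (c : ℝ)
    (𝔬12 : ∀ x : MemberY θ.d₆ θ.ℓ₆ θ.hd' θ.hL' θ.b₀ θ.b₁ Mstar, B9Thm312Whole.Ops (geo9Y x) (bg9YR (Matrix (Fin N) (Fin N) ℂ) (specialUnitaryUnits (Fin N)) R₁ R₂ x)
      (XBK (TrIdx N) x.toKIdx) (XBK (TrIdx N) x.toKIdx) (XHK (TrIdx N) x.toKIdx) (XSK (TrIdx N) x.toKIdx))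
    (bI : ∀ x : MemberY θ.d₆ θ.ℓ₆ θ.hd' θ.hL' θ.b₀ θ.b₁ Mstar, FBondY x.toKIdx → IBondY x.toKIdx)
    (hblk12 : ∀ x : MemberY θ.d₆ θ.ℓ₆ θ.hd' θ.hL' θ.b₀ θ.b₁ Mstar, (𝔬12 x).blk = blkBK x.toKIdx (bI x))
    (wC wH : ∀ x : MemberY θ.d₆ θ.ℓ₆ θ.hd' θ.hL' θ.b₀ θ.b₁ Mstar, IBondY x.toKIdx → ℝ)
    (hwC : ∀ x c, 0 ≤ wC x c) (hwH : ∀ x c, 0 ≤ wH x c) (hww : ∀ x c, wC x c * wH x c ≤ ((geo9Y x).len c ^ 2)⁻¹)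
    (κC δC tHJ ρR δ₂ θ₂ M a : ℝ) (hκC : 0 ≤ κC) (htHJ : 0 ≤ tHJ) (hρR : 0 < ρR) (hδ₂ : 0 ≤ δ₂) (hM : 0 < M)
    (hδC : δ₂ + q.αF * ((1 - 2 * q.α) * q.δ₀) + ρR ≤ δC)
    (hθ₂ : (cR39 (trBasis N))⁻¹ * (2 * N * basisBound39 (trBasis N) ^ 2 * κC * tHJ * (((θ.ℓ₆ + 1 : ℕ) : ℝ) ^ 2) *
      rowConst261 (geo9Y (d := θ.d₆) (ℓ := θ.ℓ₆) (hd := θ.hd') (hL := θ.hL') (b₀ := θ.b₀) (b₁ := θ.b₁) (Mstar := Mstar)) ρR) ≤ θ₂)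
    (hC2 : ∀ x : MemberY θ.d₆ θ.ℓ₆ θ.hd' θ.hL' θ.b₀ θ.b₁ Mstar, M ≤ (geo9Y x).M → ∀ α₀ : ℝ, 0 < α₀ → (geo9Y x).M * α₀ ≤ a →
      ∀ U : (bg9YR (Matrix (Fin N) (Fin N) ℂ) (specialUnitaryUnits (Fin N)) R₁ R₂ x).Cfg,
        (bg9YR (Matrix (Fin N) (Fin N) ℂ) (specialUnitaryUnits (Fin N)) R₁ R₂ x).Reg335 c α₀ U →
        (bg9YR (Matrix (Fin N) (Fin N) ℂ) (specialUnitaryUnits (Fin N)) R₁ R₂ x).Reg336 c α₀ U →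
          C2FormMaj x.toKIdx (g := geo9Y x) (bI x) (fun c => c) (𝔠 x).form U κC δC (wC x))
    (hHJ : ∀ x : MemberY θ.d₆ θ.ℓ₆ θ.hd' θ.hL' θ.b₀ θ.b₁ Mstar, M ≤ (geo9Y x).M → ∀ α₀ : ℝ, 0 < α₀ → (geo9Y x).M * α₀ ≤ a →
      ∀ U : (bg9YR (Matrix (Fin N) (Fin N) ℂ) (specialUnitaryUnits (Fin N)) R₁ R₂ x).Cfg,
        (bg9YR (Matrix (Fin N) (Fin N) ℂ) (specialUnitaryUnits (Fin N)) R₁ R₂ x).Reg335 c α₀ U →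
        (bg9YR (Matrix (Fin N) (Fin N) ℂ) (specialUnitaryUnits (Fin N)) R₁ R₂ x).Reg336 c α₀ U →
          ∀ c : IBondY x.toKIdx,
            ‖trAdjY (trDualMatY N) (HDY x.toKIdx (parSymY x.toKIdx) (parBY x.toKIdx) (GpPhysY x.toKIdx (parSymY x.toKIdx)) U) (JY x.toKIdx U) c‖ ≤
              tHJ * ((geo9Y x).M * α₀) * wH x c) :
    ∃ ML : ℝ, ∀ x : MemberY θ.d₆ θ.ℓ₆ θ.hd' θ.hL' θ.b₀ θ.b₁ Mstar, ML ≤ (geo9Y x).M → M ≤ (geo9Y x).M → ∀ α₀ : ℝ, 0 < α₀ → (geo9Y x).M * α₀ ≤ a →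
      ∀ U : (bg9YR (Matrix (Fin N) (Fin N) ℂ) (specialUnitaryUnits (Fin N)) R₁ R₂ x).Cfg,
        (bg9YR (Matrix (Fin N) (Fin N) ℂ) (specialUnitaryUnits (Fin N)) R₁ R₂ x).Reg335 c α₀ U →
        (bg9YR (Matrix (Fin N) (Fin N) ℂ) (specialUnitaryUnits (Fin N)) R₁ R₂ x).Reg336 c α₀ U →
          HasMajorant (g := toB6 (geo9Y x) 1 (H x)) (𝔬12 x).blk
            (D2coK x.toKIdx (trBasis N) (bg9YR (Matrix (Fin N) (Fin N) ℂ) (specialUnitaryUnits (Fin N)) R₁ R₂ x) (fun U => U) (delta2OfY (trDualMatY N) x.toKIdx (parSymY x.toKIdx) (parBY x.toKIdx) (GpPhysY x.toKIdx (parSymY x.toKIdx)) (𝔠 x).form) U)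
            (fun (a b : (geo9Y x).Site) => θ₂ * ((geo9Y x).M * α₀) * ((geo9Y x).len a ^ 2)⁻¹ * Real.exp (-(δ₂ * (geo9Y x).dist a b))) := by
  obtain ⟨Mth, -, hfacts, -⟩ :=
    lemma21Pack_geo9Y (d := θ.d₆) (ℓ := θ.ℓ₆) (hd := θ.hd') (hL := θ.hL') (b₀ := θ.b₀) (b₁ := θ.b₁) (Mstar := Mstar) H hq.α_pos hq.α_lt
      hq.δ₀_pos hq.αF_pos (by linarith only [hq.αF_lt])
  obtain ⟨MLσ, hrowc⟩ := rowConst261_spec_of_rowSum261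
    (rowSum261_geo9Y (d := θ.d₆) (ℓ := θ.ℓ₆) (hd := θ.hd') (hL := θ.hL') (b₀ := θ.b₀) (b₁ := θ.b₁) (Mstar := Mstar)) hρR
  have hN : 0 < N := Nat.pos_of_ne_zero (NeZero.ne N)
  have hc0 : 0 < cR39 (trBasis N) := cR39_trBasis_pos hN
  have hτ : 0 ≤ q.αF * ((1 - 2 * q.α) * q.δ₀) :=
    mul_nonneg hq.αF_pos.le (mul_nonneg (by linarith only [hq.α_lt]) hq.δ₀_pos.le)
  refine ⟨max Mth MLσ, fun x hMx hMM α₀ hα ha U hU hU' => ?_⟩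
  have hgeo : GeoOK (geo9Y x) := ⟨geo9Y_dist_triangle x, geo9Y_dist_comm x, geo9K_dist_nonneg x.toKIdx, geo9Y_len_pos x⟩
  have hF := hfacts x ((le_max_left _ _).trans hMx)
  have hθ : 0 ≤ (geo9Y x).M * α₀ := mul_nonneg (hM.le.trans hMM) hα.le
  -- p. 398 transfer for the net weight (Lʲη)⁻² ≥ w_C·w_H
  have hL1 : 1 ≤ (geo9Y x).L := hF.one_le_L
  have hLle : (geo9Y x).L ^ |(-2 : ℝ)| ≤ ((θ.ℓ₆ + 1 : ℕ) : ℝ) ^ 2 := by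
    rw [show |(-2 : ℝ)| = (2 : ℕ) by norm_num, Real.rpow_natCast]
    exact pow_le_pow_left₀ (zero_le_one.trans hL1) hF.L_le 2
  have hT : ∀ (y : (geo9Y x).Site) (c : IBondY x.toKIdx),
      Real.exp (-(q.αF * ((1 - 2 * q.α) * q.δ₀) * (geo9Y x).dist y c)) * (wC x c * wH x c) ≤
        ((θ.ℓ₆ + 1 : ℕ) : ℝ) ^ 2 * ((geo9Y x).len y ^ 2)⁻¹ := by
    intro y c
    have hst := scaleTransfer_len_rpow hF (-2) (by norm_num) y c
    have hc := geo9Y_len_pos x c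
    have hy := geo9Y_len_pos x y
    have e1 : ((geo9Y x).len c ^ 2)⁻¹ = (geo9Y x).len c ^ (-2 : ℝ) := by
      rw [show (-2 : ℝ) = -((2 : ℕ) : ℝ) by norm_num, Real.rpow_neg hc.le, Real.rpow_natCast]
    have e2 : ((geo9Y x).len y ^ 2)⁻¹ = (geo9Y x).len y ^ (-2 : ℝ) := by
      rw [show (-2 : ℝ) = -((2 : ℕ) : ℝ) by norm_num, Real.rpow_neg hy.le, Real.rpow_natCast]
    calc Real.exp (-(q.αF * ((1 - 2 * q.α) * q.δ₀) * (geo9Y x).dist y c)) * (wC x c * wH x c)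
        ≤ Real.exp (-(q.αF * ((1 - 2 * q.α) * q.δ₀) * (geo9Y x).dist y c)) * (geo9Y x).len c ^ (-2 : ℝ) := by
          rw [← e1]; exact mul_le_mul_of_nonneg_left (hww x c) (Real.exp_nonneg _)
      _ ≤ ((θ.ℓ₆ + 1 : ℕ) : ℝ) ^ 2 * ((geo9Y x).len y ^ 2)⁻¹ := by
          rw [e2]; exact hst.trans (mul_le_mul_of_nonneg_right hLle (Real.rpow_nonneg hy.le _))
  have hR : ∀ y : (geo9Y x).Site, ∑ c : IBondY x.toKIdx, Real.exp (-(ρR * (geo9Y x).dist y c)) ≤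
      rowConst261 (geo9Y (d := θ.d₆) (ℓ := θ.ℓ₆) (hd := θ.hd') (hL := θ.hL') (b₀ := θ.b₀) (b₁ := θ.b₁) (Mstar := Mstar)) ρR := by
    intro y
    have h := hrowc x ((le_max_right _ _).trans hMx) y
    have huniv : (Finset.univ : Finset (IBondY x.toKIdx)) =
        @Finset.univ (geo9Y x).Site (‹∀ x : MemberY θ.d₆ θ.ℓ₆ θ.hd' θ.hL' θ.b₀ θ.b₁ Mstar, Fintype (geo9Y x).Site› x) := by
      ext c
      exact ⟨fun _ => @Finset.mem_univ (geo9Y x).Site (‹∀ x : MemberY θ.d₆ θ.ℓ₆ θ.hd' θ.hL' θ.b₀ θ.b₁ Mstar, Fintype (geo9Y x).Site› x) c,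
        fun _ => Finset.mem_univ c⟩
    rw [huniv]; exact h
  have hmain := hasMajorant_coordOpK_delta2OfY x.toKIdx (parSymY x.toKIdx) (parBY x.toKIdx) (GpPhysY x.toKIdx (parSymY x.toKIdx)) (𝔠 x).form
    (g := geo9Y x) (R₀ := 1) (H₀ := H x) hgeo (bI x) (fun c => c) U
    (κC := κC) (δC := δC) (tHJ := tHJ * ((geo9Y x).M * α₀)) (ρT := q.αF * ((1 - 2 * q.α) * q.δ₀)) (CT := ((θ.ℓ₆ + 1 : ℕ) : ℝ) ^ 2)
    (ρR := ρR) (cR := rowConst261 (geo9Y (d := θ.d₆) (ℓ := θ.ℓ₆) (hd := θ.hd') (hL := θ.hL') (b₀ := θ.b₀) (b₁ := θ.b₁) (Mstar := Mstar)) ρR)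
    (δ₂ := δ₂) (r := (cR39 (trBasis N))⁻¹) (wC := wC x) (wH := wH x) (W := fun y => ((geo9Y x).len y ^ 2)⁻¹)
    hκC (hwC x) (mul_nonneg htHJ hθ) (hwH x) (by positivity)
    (fun y => inv_nonneg.mpr (pow_nonneg (geo9Y_len_pos x y).le 2)) (inv_nonneg.mpr hc0.le) hδ₂ hτ hρR.le hδC
    (hC2 x hMM α₀ hα ha U hU hU') (hHJ x hMM α₀ hα ha U hU hU') hT hR
  rw [hblk12 x]
  refine hasMajorant_mono _ hmain fun y y' => ?_
  exact kernel_dom hθ₂ hθ (inv_nonneg.mpr (pow_nonneg (geo9Y_len_pos x y).le 2)) (Real.exp_nonneg _)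

/-- ★★ (the SCALED `G′_phys` TWIN of `…N06HTransposeAtPinsPhysR.hHT_of_GD_C_lettersR`: `isTransposePair_HcoK_HDY_physY`, and `hasMajorantHom_CQG_of_letters_sq` carrying `G_D`'s `(Lʲη)_a²` to the coarse weight `W_C·(Lʲη)²`; free rates `ρG ∕ δCz ∕ ρT`, transfer `τT`, row sum `σT`) **F8′'s TRANSPOSE LETTER `hHT` AT THE EXPLICIT FAMILY `𝔗 := (C ∘ Q) ∘ G_D`, FROM THE `G_D` AND WEIGHTED-`C` SUP LETTERS** (module docstring): above
ONE threshold and in the regime, (i) `IsTransposePair (HcoK … (HDY … GpY …) U) ((CcoK … U ∘ₗ QcoKH … U) ∘ₗ GcoK … (GDY …) U)` (a THEOREM at `SU(N)`-valued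
`U`) and (ii) its [4]-(2.51) majorant `r_C·c₁·W_C(c)·(e^{δ₀(ℓ+4)}·c₁·1·r_G)·e^{−(1−α)δ₀ d(c,y′)}` from the fine carrier (blocks `bI x`) to the coarse one.
[cite: Balaban1985BackgroundPropagators, (3.126) p.420, (3.130) p.421, (3.132)–(3.133) p.422, (3.12)–(3.14) p.393, Thm 3.11 p.416; Balaban1984PropagatorsII, (2.51)–(2.56) pp.232–233, Lemma 2.1 (2.61) p.234] -/
theorem hHT_of_GD_C_lettersRP_sq (H : MemberY θ.d₆ θ.ℓ₆ θ.hd' θ.hL' θ.b₀ θ.b₁ Mstar → Prop)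
    (R₁ R₂ : RegFamY θ.d₆ θ.ℓ₆ θ.hd' θ.hL' θ.b₀ θ.b₁ Mstar (Matrix (Fin N) (Fin N) ℂ)) (hG : MemOfFam (specialUnitaryUnits (Fin N)) R₁) (c : ℝ)
    (bI : ∀ x : MemberY θ.d₆ θ.ℓ₆ θ.hd' θ.hL' θ.b₀ θ.b₁ Mstar, FBondY x.toKIdx → IBondY x.toKIdx)
    (hβ1 : ∀ (x : MemberY θ.d₆ θ.ℓ₆ θ.hd' θ.hL' θ.b₀ θ.b₁ Mstar) (f : FBondY x.toKIdx), (geomT x.D).dist (β x.hN x.D x.hk (bI x f)) (blkV1 x.hN x.D f) ≤ 1)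
    (WC : ∀ x : MemberY θ.d₆ θ.ℓ₆ θ.hd' θ.hL' θ.b₀ θ.b₁ Mstar, IBondY x.toKIdx → ℝ) (hWC : ∀ x c, 0 ≤ WC x c)
    (rG ρG rC δCz σT τT ρT M a : ℝ) (hrG : 0 ≤ rG) (hrC : 0 ≤ rC) (hσT : 0 < σT) (hτT : 0 < τT) (hρT : 0 ≤ ρT) (hρTG : ρT ≤ ρG)
    (hρTC : ρT + σT + τT ≤ δCz)
    (hGDsup : ∀ x : MemberY θ.d₆ θ.ℓ₆ θ.hd' θ.hL' θ.b₀ θ.b₁ Mstar, M ≤ (geo9Y x).M → ∀ α₀ : ℝ, 0 < α₀ → (geo9Y x).M * α₀ ≤ a →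
      ∀ U : (bg9YR (Matrix (Fin N) (Fin N) ℂ) (specialUnitaryUnits (Fin N)) R₁ R₂ x).Cfg,
        (bg9YR (Matrix (Fin N) (Fin N) ℂ) (specialUnitaryUnits (Fin N)) R₁ R₂ x).Reg335 c α₀ U →
        (bg9YR (Matrix (Fin N) (Fin N) ℂ) (specialUnitaryUnits (Fin N)) R₁ R₂ x).Reg336 c α₀ U →
          HasMajorant (g := toB6 (geo9Y x) 1 (H x)) (blkBK x.toKIdx (bI x))
            (GcoK x.toKIdx (trBasis N) (bg9YR (Matrix (Fin N) (Fin N) ℂ) (specialUnitaryUnits (Fin N)) R₁ R₂ x) (fun U => U)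
              (GDY x.toKIdx (parSymY x.toKIdx) (parBY x.toKIdx) (GpPhysY x.toKIdx (parSymY x.toKIdx))) U)
            (fun a b => rG * (geo9Y x).len a ^ 2 * Real.exp (-(ρG * (geo9Y x).dist a b))))
    (hCsup : ∀ x : MemberY θ.d₆ θ.ℓ₆ θ.hd' θ.hL' θ.b₀ θ.b₁ Mstar, M ≤ (geo9Y x).M → ∀ α₀ : ℝ, 0 < α₀ → (geo9Y x).M * α₀ ≤ a →
      ∀ U : (bg9YR (Matrix (Fin N) (Fin N) ℂ) (specialUnitaryUnits (Fin N)) R₁ R₂ x).Cfg,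
        (bg9YR (Matrix (Fin N) (Fin N) ℂ) (specialUnitaryUnits (Fin N)) R₁ R₂ x).Reg335 c α₀ U →
        (bg9YR (Matrix (Fin N) (Fin N) ℂ) (specialUnitaryUnits (Fin N)) R₁ R₂ x).Reg336 c α₀ U →
          HasMajorant (g := toB6 (geo9Y x) 1 (H x)) (blkHK x.toKIdx)
            (CcoK x.toKIdx (trBasis N) (bg9YR (Matrix (Fin N) (Fin N) ℂ) (specialUnitaryUnits (Fin N)) R₁ R₂ x) (fun U => U)
              (parSymY x.toKIdx) (parBY x.toKIdx) (GpPhysY x.toKIdx (parSymY x.toKIdx)) U)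
            (fun a b => rC * WC x a * Real.exp (-(δCz * (geo9Y x).dist a b)))) :
    ∃ MT : ℝ, ∀ x : MemberY θ.d₆ θ.ℓ₆ θ.hd' θ.hL' θ.b₀ θ.b₁ Mstar, MT ≤ (geo9Y x).M → M ≤ (geo9Y x).M → ∀ α₀ : ℝ, 0 < α₀ → (geo9Y x).M * α₀ ≤ a →
      ∀ U : (bg9YR (Matrix (Fin N) (Fin N) ℂ) (specialUnitaryUnits (Fin N)) R₁ R₂ x).Cfg,
        (bg9YR (Matrix (Fin N) (Fin N) ℂ) (specialUnitaryUnits (Fin N)) R₁ R₂ x).Reg335 c α₀ U →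
        (bg9YR (Matrix (Fin N) (Fin N) ℂ) (specialUnitaryUnits (Fin N)) R₁ R₂ x).Reg336 c α₀ U →
          IsTransposePair (HcoK x.toKIdx (trBasis N) (bg9YR (Matrix (Fin N) (Fin N) ℂ) (specialUnitaryUnits (Fin N)) R₁ R₂ x) (fun U => U)
              (HDY x.toKIdx (parSymY x.toKIdx) (parBY x.toKIdx) (GpPhysY x.toKIdx (parSymY x.toKIdx))) U)
            ((CcoK x.toKIdx (trBasis N) (bg9YR (Matrix (Fin N) (Fin N) ℂ) (specialUnitaryUnits (Fin N)) R₁ R₂ x) (fun U => U)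
                (parSymY x.toKIdx) (parBY x.toKIdx) (GpPhysY x.toKIdx (parSymY x.toKIdx)) U ∘ₗ
              QcoKH x.toKIdx (trBasis N) (bg9YR (Matrix (Fin N) (Fin N) ℂ) (specialUnitaryUnits (Fin N)) R₁ R₂ x) (fun U => U) (parBY x.toKIdx) U) ∘ₗ
              GcoK x.toKIdx (trBasis N) (bg9YR (Matrix (Fin N) (Fin N) ℂ) (specialUnitaryUnits (Fin N)) R₁ R₂ x) (fun U => U)
                (GDY x.toKIdx (parSymY x.toKIdx) (parBY x.toKIdx) (GpPhysY x.toKIdx (parSymY x.toKIdx))) U) ∧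
            HasMajorantHom (g := toB6 (geo9Y x) 1 (H x)) (fun p : XBK (TrIdx N) x.toKIdx => bI x p.1) (fun p : XHK (TrIdx N) x.toKIdx => p.1)
              ((CcoK x.toKIdx (trBasis N) (bg9YR (Matrix (Fin N) (Fin N) ℂ) (specialUnitaryUnits (Fin N)) R₁ R₂ x) (fun U => U)
                  (parSymY x.toKIdx) (parBY x.toKIdx) (GpPhysY x.toKIdx (parSymY x.toKIdx)) U ∘ₗ
                QcoKH x.toKIdx (trBasis N) (bg9YR (Matrix (Fin N) (Fin N) ℂ) (specialUnitaryUnits (Fin N)) R₁ R₂ x) (fun U => U) (parBY x.toKIdx) U) ∘ₗ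
                GcoK x.toKIdx (trBasis N) (bg9YR (Matrix (Fin N) (Fin N) ℂ) (specialUnitaryUnits (Fin N)) R₁ R₂ x) (fun U => U)
                  (GDY x.toKIdx (parSymY x.toKIdx) (parBY x.toKIdx) (GpPhysY x.toKIdx (parSymY x.toKIdx))) U)
              (fun c y' => (rC * (Real.exp ((ρG + σT + 1 / 2 * (2 * τT)) * ((θ.ℓ₆ : ℝ) + 4)) * rG * (((θ.ℓ₆ + 1 : ℕ) : ℝ)) ^ 2 * rowConst261 (geo9Y (d := θ.d₆) (ℓ := θ.ℓ₆) (hd := θ.hd') (hL := θ.hL') (b₀ := θ.b₀) (b₁ := θ.b₁) (Mstar := Mstar)) σT) * (((θ.ℓ₆ + 1 : ℕ) : ℝ)) ^ 2 * rowConst261 (geo9Y (d := θ.d₆) (ℓ := θ.ℓ₆) (hd := θ.hd') (hL := θ.hL') (b₀ := θ.b₀) (b₁ := θ.b₁) (Mstar := Mstar)) σT) *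
                (WC x c * (geo9Y x).len c ^ 2) * Real.exp (-(ρT * (geo9Y x).dist c y'))) := by
  obtain ⟨Mg, hFa⟩ := facts347_exp261_geo9Y (d := θ.d₆) (ℓ := θ.ℓ₆) (hd := θ.hd') (hL := θ.hL') (b₀ := θ.b₀) (b₁ := θ.b₁) (Mstar := Mstar) H (α := 1 / 2) (δ := 2 * τT)
    (by norm_num) (by norm_num) (by linarith)
  obtain ⟨ML, hrow⟩ := rowConst261_spec_of_rowSum261
    (rowSum261_geo9Y (d := θ.d₆) (ℓ := θ.ℓ₆) (hd := θ.hd') (hL := θ.hL') (b₀ := θ.b₀) (b₁ := θ.b₁) (Mstar := Mstar)) hσT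
  have hN : 0 < N := Nat.pos_of_ne_zero (NeZero.ne N)
  have hcR : 0 ≤ rowConst261 (geo9Y (d := θ.d₆) (ℓ := θ.ℓ₆) (hd := θ.hd') (hL := θ.hL') (b₀ := θ.b₀) (b₁ := θ.b₁) (Mstar := Mstar)) σT := rowConst261_nonneg _ _
  refine ⟨max Mg ML, fun x hMx hMM α₀ hα ha U hU hU' => ?_⟩
  have hGv : ∀ μ z, U μ z ∈ specialUnitaryUnits (Fin N) := hG x c α₀ U hU
  refine ⟨isTransposePair_HcoK_HDY_physY x.toKIdx (bg9YR (Matrix (Fin N) (Fin N) ℂ) (specialUnitaryUnits (Fin N)) R₁ R₂ x) (fun U => U)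
    specialUnitaryUnits_le_unitaryUnits hN U hGv, ?_⟩
  letI : Fintype (geo9K x.toKIdx).Site := (inferInstance : Fintype (geo9Y x).Site)
  have hGK : GeoOK (geo9K x.toKIdx) := ⟨geo9Y_dist_triangle x, geo9Y_dist_comm x, geo9K_dist_nonneg x.toKIdx, geo9Y_len_pos x⟩
  have hrowx : RowSum (toB6 (geo9K x.toKIdx) 1 (H x)) σT (rowConst261 (geo9Y (d := θ.d₆) (ℓ := θ.ℓ₆) (hd := θ.hd') (hL := θ.hL') (b₀ := θ.b₀) (b₁ := θ.b₁) (Mstar := Mstar)) σT) := fun y => hrow x ((le_max_right _ _).trans hMx) y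
  have h := hasMajorantHom_CQG_of_letters_sq (R₀ := 1) (H₀ := H x) x.toKIdx (bg9YR (Matrix (Fin N) (Fin N) ℂ) (specialUnitaryUnits (Fin N)) R₁ R₂ x) (fun U => U)
    (hβ1 x) U (fun s s' => specialUnitaryUnits_le_U1 (Node00.parBY_mem x.toKIdx (G := specialUnitaryUnits (Fin N)) hGv s s')) hGK (hFa x ((le_max_left _ _).trans hMx))
    hrowx hcR hσT.le (by linarith) hρT hρTG (by linarith) hrG hrC (hWC x)
    (hGDsup x hMM α₀ hα ha U hU hU') (hCsup x hMM α₀ hα ha U hU hU')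
  refine B6RandomWalkHom.hasMajorantHom_mono _ _ h fun a b => le_of_eq ?_
  have hd : (geo9Y x).dist a b = (geo9K x.toKIdx).dist a b := rfl
  have hl : (geo9Y x).len a = (geo9K x.toKIdx).len a := rfl
  rw [hd, hl]

/-- ★★★ (the SCALED `G′_phys` TWIN of `…N06HTransposeAtPinsPhysR.hD2sup_of_GD_C_lettersR`: `G_D`'s letter with print's `(Lʲη)_a²`, free rates, the `(H\*J)` step through dag-n08-d's generic-letter wrapper at the coarse weight `W_C·(Lʲη)²`) **THE CERTIFICATE's `hD2sup` AT def-Y's `G′_phys`-FED RESIDUAL `delta2OfY … GpPhysY … (𝔠 x).form` (= `resYOfC2P … 𝔠`) FROM `hC2 + hreg + hGDsup + hCsup`** (F6 `hD2sup_of_form_schemas_w` ∘ F8′ (`…N06HstarJAtPinsWPhys`) ∘ `hHT_of_GD_C_letters`):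
the `(H\*J)` letter `hHJ` AND the transpose letter `hHT` ELIMINATED; what stays displayed on this road is [5] (149) (`hC2`, weight `w_C` with
`w_C·W_C·(Lʲη)⁻³ ≦ (Lʲη)⁻²`), the cube covering (`hreg`), Thm 3.12's `G_D` sup letter (`hGDsup`) and the weighted (3.132) letter (`hCsup`).  (Edition 29's
`hD2L2` follows the same way through F8′ (`…N06HstarJAtPinsWPhys`)'s `hD2L2_of_transpose_schemas_w` with def-Y's reality letters `hC hH`.)
[cite: Balaban1985BackgroundPropagators, (3.136)–(3.137) pp.422–423, (3.134) p.422, (3.126) p.420, (3.130) p.421, (3.132)–(3.133) p.422, (3.36) p.396, p.398; Balaban1985Averaging, (149) p.40; Balaban1984PropagatorsII, (2.51) p.232, (2.54), (2.60)–(2.61) pp.233–234] -/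
theorem hD2sup_of_GD_C_lettersRP_sq (q : PinPrims) (hq : q.OK) (H : MemberY θ.d₆ θ.ℓ₆ θ.hd' θ.hL' θ.b₀ θ.b₁ Mstar → Prop) (𝔠 : C2Y N θ Mstar)
    (R₁ R₂ : RegFamY θ.d₆ θ.ℓ₆ θ.hd' θ.hL' θ.b₀ θ.b₁ Mstar (Matrix (Fin N) (Fin N) ℂ)) (hG : MemOfFam (specialUnitaryUnits (Fin N)) R₁) (c : ℝ)
    (𝔬12 : ∀ x : MemberY θ.d₆ θ.ℓ₆ θ.hd' θ.hL' θ.b₀ θ.b₁ Mstar, B9Thm312Whole.Ops (geo9Y x) (bg9YR (Matrix (Fin N) (Fin N) ℂ) (specialUnitaryUnits (Fin N)) R₁ R₂ x)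
      (XBK (TrIdx N) x.toKIdx) (XBK (TrIdx N) x.toKIdx) (XHK (TrIdx N) x.toKIdx) (B9CoReadingCoordsS.XSK (TrIdx N) x.toKIdx))
    (bI : ∀ x : MemberY θ.d₆ θ.ℓ₆ θ.hd' θ.hL' θ.b₀ θ.b₁ Mstar, FBondY x.toKIdx → IBondY x.toKIdx)
    (hbI0 : ∀ (x : MemberY θ.d₆ θ.ℓ₆ θ.hd' θ.hL' θ.b₀ θ.b₁ Mstar) (f : FBondY x.toKIdx), bI x f = bI x ⟨f.src, 0⟩)
    (hβ1 : ∀ (x : MemberY θ.d₆ θ.ℓ₆ θ.hd' θ.hL' θ.b₀ θ.b₁ Mstar) (f : FBondY x.toKIdx), (geomT x.D).dist (β x.hN x.D x.hk (bI x f)) (blkV1 x.hN x.D f) ≤ 1)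
    (hblk12 : ∀ x : MemberY θ.d₆ θ.ℓ₆ θ.hd' θ.hL' θ.b₀ θ.b₁ Mstar, (𝔬12 x).blk = blkBK x.toKIdx (bI x))
    (wC WC : ∀ x : MemberY θ.d₆ θ.ℓ₆ θ.hd' θ.hL' θ.b₀ θ.b₁ Mstar, IBondY x.toKIdx → ℝ) (hwC : ∀ x c, 0 ≤ wC x c) (hWC : ∀ x c, 0 ≤ WC x c)
    (hww : ∀ x c, wC x c * ((WC x c * (geo9Y x).len c ^ 2) * ((geo9Y x).len c ^ 3)⁻¹) ≤ ((geo9Y x).len c ^ 2)⁻¹)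
    (κC δC rG ρG rC δCz σT τT ρT cJ ρR tHJ δ₂ θ₂ M a : ℝ) (hκC : 0 ≤ κC) (hrG : 0 ≤ rG) (hrC : 0 ≤ rC) (hσT : 0 < σT) (hτT : 0 < τT) (hρT : 0 ≤ ρT)
    (hρTG : ρT ≤ ρG) (hρTC : ρT + σT + τT ≤ δCz) (hcJ : 0 ≤ cJ) (hρR : 0 < ρR) (hδ₂ : 0 ≤ δ₂) (hM : 0 < M)
    (ha1 : cJ * a ≤ 1) (hδC : δ₂ + q.αF * ((1 - 2 * q.α) * q.δ₀) + ρR ≤ δC) (hρ : q.αF * ((1 - 2 * q.α) * q.δ₀) + ρR ≤ ρT)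
    (htHJ : N * basisBound39 (trBasis N) ^ 2 * (10 ^ 4 * ((θ.d₆ : ℝ) + 1) * cJ) *
      (((θ.d₆ : ℝ) + 1) * Fintype.card (TrIdx N) *
        (rC * (Real.exp ((ρG + σT + 1 / 2 * (2 * τT)) * ((θ.ℓ₆ : ℝ) + 4)) * rG * (((θ.ℓ₆ + 1 : ℕ) : ℝ)) ^ 2 * rowConst261 (geo9Y (d := θ.d₆) (ℓ := θ.ℓ₆) (hd := θ.hd') (hL := θ.hL') (b₀ := θ.b₀) (b₁ := θ.b₁) (Mstar := Mstar)) σT) * (((θ.ℓ₆ + 1 : ℕ) : ℝ)) ^ 2 * rowConst261 (geo9Y (d := θ.d₆) (ℓ := θ.ℓ₆) (hd := θ.hd') (hL := θ.hL') (b₀ := θ.b₀) (b₁ := θ.b₁) (Mstar := Mstar)) σT)) *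
      ((((θ.ℓ₆ + 1 : ℕ) : ℝ) ^ 3) * rowConst261 (geo9Y (d := θ.d₆) (ℓ := θ.ℓ₆) (hd := θ.hd') (hL := θ.hL') (b₀ := θ.b₀) (b₁ := θ.b₁) (Mstar := Mstar)) ρR) ≤ tHJ)
    (hθ₂ : (B9Thm39ReadingCoords.cR39 (trBasis N))⁻¹ * (2 * N * basisBound39 (trBasis N) ^ 2 * κC * tHJ * (((θ.ℓ₆ + 1 : ℕ) : ℝ) ^ 2) *
      rowConst261 (geo9Y (d := θ.d₆) (ℓ := θ.ℓ₆) (hd := θ.hd') (hL := θ.hL') (b₀ := θ.b₀) (b₁ := θ.b₁) (Mstar := Mstar)) ρR) ≤ θ₂)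
    (hC2 : ∀ x : MemberY θ.d₆ θ.ℓ₆ θ.hd' θ.hL' θ.b₀ θ.b₁ Mstar, M ≤ (geo9Y x).M → ∀ α₀ : ℝ, 0 < α₀ → (geo9Y x).M * α₀ ≤ a →
      ∀ U : (bg9YR (Matrix (Fin N) (Fin N) ℂ) (specialUnitaryUnits (Fin N)) R₁ R₂ x).Cfg,
        (bg9YR (Matrix (Fin N) (Fin N) ℂ) (specialUnitaryUnits (Fin N)) R₁ R₂ x).Reg335 c α₀ U →
        (bg9YR (Matrix (Fin N) (Fin N) ℂ) (specialUnitaryUnits (Fin N)) R₁ R₂ x).Reg336 c α₀ U →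
          B9Delta2FormMajorant.C2FormMaj x.toKIdx (g := geo9Y x) (bI x) (fun c => c) (𝔠 x).form U κC δC (wC x))
    (hGDsup : ∀ x : MemberY θ.d₆ θ.ℓ₆ θ.hd' θ.hL' θ.b₀ θ.b₁ Mstar, M ≤ (geo9Y x).M → ∀ α₀ : ℝ, 0 < α₀ → (geo9Y x).M * α₀ ≤ a →
      ∀ U : (bg9YR (Matrix (Fin N) (Fin N) ℂ) (specialUnitaryUnits (Fin N)) R₁ R₂ x).Cfg,
        (bg9YR (Matrix (Fin N) (Fin N) ℂ) (specialUnitaryUnits (Fin N)) R₁ R₂ x).Reg335 c α₀ U →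
        (bg9YR (Matrix (Fin N) (Fin N) ℂ) (specialUnitaryUnits (Fin N)) R₁ R₂ x).Reg336 c α₀ U →
          HasMajorant (g := toB6 (geo9Y x) 1 (H x)) (blkBK x.toKIdx (bI x))
            (GcoK x.toKIdx (trBasis N) (bg9YR (Matrix (Fin N) (Fin N) ℂ) (specialUnitaryUnits (Fin N)) R₁ R₂ x) (fun U => U)
              (GDY x.toKIdx (parSymY x.toKIdx) (parBY x.toKIdx) (GpPhysY x.toKIdx (parSymY x.toKIdx))) U)
            (fun a b => rG * (geo9Y x).len a ^ 2 * Real.exp (-(ρG * (geo9Y x).dist a b))))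
    (hCsup : ∀ x : MemberY θ.d₆ θ.ℓ₆ θ.hd' θ.hL' θ.b₀ θ.b₁ Mstar, M ≤ (geo9Y x).M → ∀ α₀ : ℝ, 0 < α₀ → (geo9Y x).M * α₀ ≤ a →
      ∀ U : (bg9YR (Matrix (Fin N) (Fin N) ℂ) (specialUnitaryUnits (Fin N)) R₁ R₂ x).Cfg,
        (bg9YR (Matrix (Fin N) (Fin N) ℂ) (specialUnitaryUnits (Fin N)) R₁ R₂ x).Reg335 c α₀ U →
        (bg9YR (Matrix (Fin N) (Fin N) ℂ) (specialUnitaryUnits (Fin N)) R₁ R₂ x).Reg336 c α₀ U →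
          HasMajorant (g := toB6 (geo9Y x) 1 (H x)) (blkHK x.toKIdx)
            (CcoK x.toKIdx (trBasis N) (bg9YR (Matrix (Fin N) (Fin N) ℂ) (specialUnitaryUnits (Fin N)) R₁ R₂ x) (fun U => U)
              (parSymY x.toKIdx) (parBY x.toKIdx) (GpPhysY x.toKIdx (parSymY x.toKIdx)) U)
            (fun a b => rC * WC x a * Real.exp (-(δCz * (geo9Y x).dist a b))))
    (hreg : ∀ x : MemberY θ.d₆ θ.ℓ₆ θ.hd' θ.hL' θ.b₀ θ.b₁ Mstar, M ≤ (geo9Y x).M → ∀ α₀ : ℝ, 0 < α₀ → (geo9Y x).M * α₀ ≤ a →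
      ∀ U : (bg9YR (Matrix (Fin N) (Fin N) ℂ) (specialUnitaryUnits (Fin N)) R₁ R₂ x).Cfg,
        (bg9YR (Matrix (Fin N) (Fin N) ℂ) (specialUnitaryUnits (Fin N)) R₁ R₂ x).Reg335 c α₀ U →
        (bg9YR (Matrix (Fin N) (Fin N) ℂ) (specialUnitaryUnits (Fin N)) R₁ R₂ x).Reg336 c α₀ U →
          ∀ μ s, RegularAt (shiftsV1 (PV θ.d₆ θ.ℓ₆ x.toKIdx.m x.toKIdx.K θ.hd' θ.hL')) U (etaBY x.toKIdx)
            (cJ * ((geo9Y x).M * α₀)) ((geo9Y x).len (bI x ⟨s, 0⟩)) μ s) :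
    ∃ ML : ℝ, ∀ x : MemberY θ.d₆ θ.ℓ₆ θ.hd' θ.hL' θ.b₀ θ.b₁ Mstar, ML ≤ (geo9Y x).M → M ≤ (geo9Y x).M → ∀ α₀ : ℝ, 0 < α₀ → (geo9Y x).M * α₀ ≤ a →
      ∀ U : (bg9YR (Matrix (Fin N) (Fin N) ℂ) (specialUnitaryUnits (Fin N)) R₁ R₂ x).Cfg,
        (bg9YR (Matrix (Fin N) (Fin N) ℂ) (specialUnitaryUnits (Fin N)) R₁ R₂ x).Reg335 c α₀ U →
        (bg9YR (Matrix (Fin N) (Fin N) ℂ) (specialUnitaryUnits (Fin N)) R₁ R₂ x).Reg336 c α₀ U →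
          HasMajorant (g := toB6 (geo9Y x) 1 (H x)) (𝔬12 x).blk
            (B9PerturbationL2Delta2.D2coK x.toKIdx (trBasis N) (bg9YR (Matrix (Fin N) (Fin N) ℂ) (specialUnitaryUnits (Fin N)) R₁ R₂ x) (fun U => U)
              (delta2OfY (trDualMatY N) x.toKIdx (parSymY x.toKIdx) (parBY x.toKIdx) (GpPhysY x.toKIdx (parSymY x.toKIdx)) (𝔠 x).form) U)
            (fun (a b : (geo9Y x).Site) => θ₂ * ((geo9Y x).M * α₀) * ((geo9Y x).len a ^ 2)⁻¹ * Real.exp (-(δ₂ * (geo9Y x).dist a b))) := by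
  obtain ⟨MT, hHT⟩ := hHT_of_GD_C_lettersRP_sq H R₁ R₂ hG c bI hβ1 WC hWC rG ρG rC δCz σT τT ρT M a hrG hrC hσT hτT hρT hρTG hρTC hGDsup hCsup
  have hM' : 0 < max M MT := lt_max_of_lt_left hM
  have hBT : 0 ≤ (rC * (Real.exp ((ρG + σT + 1 / 2 * (2 * τT)) * ((θ.ℓ₆ : ℝ) + 4)) * rG * (((θ.ℓ₆ + 1 : ℕ) : ℝ)) ^ 2 * rowConst261 (geo9Y (d := θ.d₆) (ℓ := θ.ℓ₆) (hd := θ.hd') (hL := θ.hL') (b₀ := θ.b₀) (b₁ := θ.b₁) (Mstar := Mstar)) σT) * (((θ.ℓ₆ + 1 : ℕ) : ℝ)) ^ 2 * rowConst261 (geo9Y (d := θ.d₆) (ℓ := θ.ℓ₆) (hd := θ.hd') (hL := θ.hL') (b₀ := θ.b₀) (b₁ := θ.b₁) (Mstar := Mstar)) σT) := by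
    have h2 := rowConst261_nonneg (geo9Y (d := θ.d₆) (ℓ := θ.ℓ₆) (hd := θ.hd') (hL := θ.hL') (b₀ := θ.b₀) (b₁ := θ.b₁) (Mstar := Mstar)) σT
    positivity
  -- the `(H*J)` letter for `H = HDY … GpPhysY …` by dag-n08-d's generic-letter edition of F8′ (`B9Eq3136HstarJAtPinsLetterFamily`), coarse weight `W_C·(Lʲη)²`
  obtain ⟨MH, hHJ⟩ := norm_trAdjY_JY_le_of_transpose_schemas_wR q hq H R₁ R₂ c
    (fun x U => HDY x.toKIdx (parSymY x.toKIdx) (parBY x.toKIdx) (GpPhysY x.toKIdx (parSymY x.toKIdx)) U) bI hbI0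
    (fun x U => (CcoK x.toKIdx (trBasis N) (bg9YR (Matrix (Fin N) (Fin N) ℂ) (specialUnitaryUnits (Fin N)) R₁ R₂ x) (fun U => U)
        (parSymY x.toKIdx) (parBY x.toKIdx) (GpPhysY x.toKIdx (parSymY x.toKIdx)) U ∘ₗ
      QcoKH x.toKIdx (trBasis N) (bg9YR (Matrix (Fin N) (Fin N) ℂ) (specialUnitaryUnits (Fin N)) R₁ R₂ x) (fun U => U) (parBY x.toKIdx) U) ∘ₗ
      GcoK x.toKIdx (trBasis N) (bg9YR (Matrix (Fin N) (Fin N) ℂ) (specialUnitaryUnits (Fin N)) R₁ R₂ x) (fun U => U)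
        (GDY x.toKIdx (parSymY x.toKIdx) (parBY x.toKIdx) (GpPhysY x.toKIdx (parSymY x.toKIdx))) U)
    (fun x c => WC x c * (geo9Y x).len c ^ 2) (fun x c => mul_nonneg (hWC x c) (pow_nonneg (geo9Y_len_pos x c).le 2))
    cJ _ ρT ρR tHJ (max M MT) a hcJ hBT hρR hM' ha1 hρ htHJ
    (fun x hMx α₀ hα ha U hU hU' => hHT x ((le_max_right _ _).trans hMx) ((le_max_left _ _).trans hMx) α₀ hα ha U hU hU')
    (fun x hMx α₀ hα ha U hU hU' => hreg x ((le_max_left _ _).trans hMx) α₀ hα ha U hU hU')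
  have hM'' : 0 < max (max M MT) MH := lt_max_of_lt_left hM'
  have htHJ0 : 0 ≤ tHJ := by
    have h2 := rowConst261_nonneg (geo9Y (d := θ.d₆) (ℓ := θ.ℓ₆) (hd := θ.hd') (hL := θ.hL') (b₀ := θ.b₀) (b₁ := θ.b₁) (Mstar := Mstar)) ρR
    exact le_trans (by positivity) htHJ
  obtain ⟨ML, hsup⟩ := hD2sup_of_form_schemas_wRP q hq H 𝔠 R₁ R₂ c 𝔬12 bI hblk12 wC (fun x c => (WC x c * (geo9Y x).len c ^ 2) * ((geo9Y x).len c ^ 3)⁻¹) hwC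
    (fun x c => mul_nonneg (mul_nonneg (hWC x c) (pow_nonneg (geo9Y_len_pos x c).le 2)) (inv_nonneg.mpr (pow_nonneg (geo9Y_len_pos x c).le 3))) hww
    κC δC tHJ ρR δ₂ θ₂ (max (max M MT) MH) a hκC htHJ0 hρR hδ₂ hM'' hδC hθ₂
    (fun x hMx α₀ hα ha U hU hU' => hC2 x ((le_max_left _ _).trans ((le_max_left _ _).trans hMx)) α₀ hα ha U hU hU')
    (fun x hMx α₀ hα ha U hU hU' c => hHJ x ((le_max_right _ _).trans hMx) ((le_max_left _ _).trans hMx) α₀ hα ha U hU hU' c)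
  exact ⟨max ML (max (max M MT) MH), fun x hMx hMM α₀ hα ha U hU hU' =>
    hsup x ((le_max_left _ _).trans hMx) (max_le (max_le hMM ((le_max_right _ _).trans ((le_max_left _ _).trans ((le_max_right _ _).trans hMx))))
      ((le_max_right _ _).trans ((le_max_right _ _).trans hMx))) α₀ hα ha U hU hU'⟩

end Summit.QuantumFields.YangMills.BalabanUVNodes.N06Delta2AtPinsPhysP

end
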